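import Summits.NavierStokesRegularity.NavierStokesRegularity.Theses.AxisymmetricExtremality
import Summits.NavierStokesRegularity.NavierStokesRegularity.Theorems.AxisymmetricExtremalityAxisymmetricKatoGlobalStubSeregin2020TypeIIAxisymRepr
import Literature.Analysis.FluidPDE.Seregin2020AncientLimitSymmetry
import Literature.Analysis.FluidPDE.LocalTypeICongr
import HarnessLib

/-!
# Seregin 2020, proof of Thm 2.1: the blow-up limit at an axisymmetric Type I singular point,
# properties (𝒜)(i)–(iii) and (2.9) with (𝒜)(ii) in POINTWISE form

Helper toward the stub `stub_seregin2020TypeII` of the crux `AxisymmetricKatoGlobal` (= the named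
fact `Literature.Analysis.FluidPDE.Seregin2020_axisymmetricSingularPoint_typeII`, G. Seregin,
Anal. Math. Phys. 10 (2020) Paper 46 = arXiv:2006.04140, Thm 2.1). The printed proof (arXiv p. 7)
rescales `v` at the origin under the Type I assumption `g(0) < ∞` and extracts "limit functions
`u` and `p` … that have the properties (𝒜): (i) `u` is a local energy ancient solution in
`Q₋ = ℝ³ × ]-∞, 0[` …; (ii) `u` and `p` is axially symmetric solution to the Navier–Stokes
equations in `Q₋`; (iii) for any `R > 0`, `A(u,R) + E(u,R) + C(u,R) + D(p,R) ≤ L₀ < ∞`", non-trivial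
in the sense (2.9) `a⁻² ∫_{Q(a)} |u|³ ≥ ε(L₀) > 0`.

The tree proves all of this (`Literature.Analysis.FluidPDE.Seregin2020.exists_ancientLimit_axisymmetric`,
`…exists_cknE_bound_of_forall_inBall`) except that (ii) is delivered almost everywhere only. With
the rotation-average representatives of the companion helper
(`exists_isAxisymmetric_repr`, `exists_isAxisymmetricScalar_repr`) this file records property
(𝒜) exactly as printed and as consumed by the tree's axisymmetric tools: EVERY slice `w s` is
`IsAxisymmetric` and every `π s` is `IsAxisymmetricScalar`, all the other properties being
invariant under the a.e. modification (`IsSuitableWeakSolutionInBall.congr_ae'`,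
`cknAEss_congr_ae`, `cknC_congr_ae`, `IsBackwardSingularPoint.congr_ae`), and the dissipation
bound (iii) for `E` being included (`exists_ancientLimit_isAxisymmetric`).

## References

* G. Seregin, Anal. Math. Phys. 10 (2020), Paper 46 = arXiv:2006.04140, proof of Thm. 2.1,
  properties (𝒜)(i)–(iii) and (2.9). [Seregin2020]
-/

-- the problem directory repeats the summit name (D-0017); core's `dupNamespace` linter fires
set_option linter.dupNamespace false

noncomputable section

open MeasureTheory Set Function Filter Topology TopologicalSpace Metric
open scoped NNReal ENNReal

namespace Summit.NavierStokesRegularity.NavierStokesRegularity.Theorems.AxisymmetricKatoGlobal.EulerScaling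

open Literature.Analysis.FluidPDE Literature.Analysis.FluidPDE.Seregin2020

/-- `D(Q(z,r))` is invariant under a.e. modification of the pressure on the ball. [folklore] -/
theorem cknD_congr_ae {r : ℝ} {z : ℝ × EuclideanSpace ℝ (Fin 3)}
    {p p' : ℝ → EuclideanSpace ℝ (Fin 3) → ℝ}
    (h : ∀ᵐ w ∂(volume.restrict (parabolicCylinder r z)), uncurry p w = uncurry p' w) :
    cknD r z p = cknD r z p' := by
  unfold cknD
  congr 1
  refine lintegral_congr_ae ?_
  filter_upwards [h] with w hw
  have hw' : p w.1 w.2 = p' w.1 w.2 := hw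
  simp only [hw']

/-- **Seregin 2020, proof of Thm 2.1: the blow-up limit with properties (𝒜)(i)–(iii) and (2.9),
(ii) pointwise.** Under the hypotheses of Theorem 2.1 (suitable weak solution in `Q = 𝒞 × ]-1,0[`
with the global classes of Def. 1.3, axisymmetric slices, singular origin) and the Type I
assumption `g(0) < ∞`: there are scales `λⱼ → 0`, constants `K < ∞`, `κ > 0` and a pair `(w, π)`
on `ℝ × ℝ³` such that EVERY slice `w s` is axisymmetric and every `π s` rotation invariant
((𝒜)(ii)), the origin is a backward singular point of `w`, and for every `a > 0`: `(w, π)` is a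
suitable weak solution in `Q(a)` in Albritton–Barker's class ((𝒜)(i)), `w ∈ L³(Q(a))` is the
strong `L³` limit and `π` the weak `L^{3/2}` limit of the rescaled pairs
`λⱼ v(λⱼ² s, λⱼ y)`, `λⱼ² q(λⱼ² s, λⱼ y)`, `A(w;a), C(w;a), D(π;a) ≤ K` and
`A(w;a) + E(G_a;a) ≤ K` for a weak spatial gradient `G_a` of `w` on `Q(2a)` ((𝒜)(iii)), and
`C(w;a) ≥ κ` ((2.9)). [cite: Seregin2020, proof of Thm 2.1, properties (𝒜)(i)–(iii) and (2.9)] -/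
theorem exists_ancientLimit_isAxisymmetric
    {u : ℝ → EuclideanSpace ℝ (Fin 3) → EuclideanSpace ℝ (Fin 3)}
    {p : ℝ → EuclideanSpace ℝ (Fin 3) → ℝ}
    {G : ℝ → EuclideanSpace ℝ (Fin 3) → EuclideanSpace ℝ (Fin 3) →L[ℝ] EuclideanSpace ℝ (Fin 3)}
    (hsw : IsSuitableWeakSolutionOn (SereginSverak2009.parCylOpens 0 1) 1 0 u p)
    (hA : ∃ C : ℝ≥0, ∀ᵐ t ∂(volume.restrict (Ioo (-1 : ℝ) 0)),
      ∫⁻ x in SereginSverak2009.spaceCyl 0 1, ‖u t x‖ₑ ^ 2 ≤ C)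
    (hG : HasWeakSpatialGradientOn (SereginSverak2009.parCylOpens 0 1) u G)
    (hE : ∫⁻ z in SereginSverak2009.parCyl 0 1, ENNReal.ofReal (frobeniusNormSq (G z.1 z.2)) < ∞)
    (hp : ∫⁻ z in SereginSverak2009.parCyl 0 1, ‖p z.1 z.2‖ₑ ^ (3 / 2 : ℝ) < ∞)
    (hu_ax : ∀ t ∈ Ioo (-1 : ℝ) 0, IsAxisymmetric (u t))
    (hp_ax : ∀ t ∈ Ioo (-1 : ℝ) 0, IsAxisymmetricScalar (p t))
    (hsing : IsBackwardSingularPoint u 0) (hI : blowupIndex 0 u G < ∞) :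
    ∃ (K : ℝ≥0) (κ : ℝ) (lam : ℕ → ℝ)
      (w : ℝ → EuclideanSpace ℝ (Fin 3) → EuclideanSpace ℝ (Fin 3))
      (π : ℝ → EuclideanSpace ℝ (Fin 3) → ℝ),
      0 < κ ∧ (∀ j, 0 < lam j) ∧ Tendsto lam atTop (𝓝 0) ∧
      IsBackwardSingularPoint w 0 ∧
      (∀ s, IsAxisymmetric (w s)) ∧ (∀ s, IsAxisymmetricScalar (π s)) ∧
      ∀ a : ℝ, 0 < a →
        IsSuitableWeakSolutionInBall a 0 w π ∧
        MemLp (uncurry w) 3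
          (volume.restrict (parabolicCylinder a (0 : ℝ × EuclideanSpace ℝ (Fin 3)))) ∧
        Tendsto (fun j => eLpNorm
            (uncurry ((lam j) • stPull ((lam j) ^ 2) (lam j) (0 : ℝ)
              (0 : EuclideanSpace ℝ (Fin 3)) u) - uncurry w) 3
            (volume.restrict (parabolicCylinder a (0 : ℝ × EuclideanSpace ℝ (Fin 3)))))
          atTop (𝓝 0) ∧
        (∀ g : ℝ × EuclideanSpace ℝ (Fin 3) → ℝ,
          MemLp g 3 (volume.restrict (parabolicCylinder a (0 : ℝ × EuclideanSpace ℝ (Fin 3)))) →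
          Tendsto (fun j => ∫ w' in parabolicCylinder a (0 : ℝ × EuclideanSpace ℝ (Fin 3)),
              ((lam j) ^ 2 • stPull ((lam j) ^ 2) (lam j) (0 : ℝ)
                (0 : EuclideanSpace ℝ (Fin 3)) p) w'.1 w'.2 * g w')
            atTop (𝓝 (∫ w' in parabolicCylinder a (0 : ℝ × EuclideanSpace ℝ (Fin 3)),
              π w'.1 w'.2 * g w'))) ∧
        cknAEss a (0 : ℝ × EuclideanSpace ℝ (Fin 3)) w ≤ K ∧
        cknC a (0 : ℝ × EuclideanSpace ℝ (Fin 3)) w ≤ K ∧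
        cknD a (0 : ℝ × EuclideanSpace ℝ (Fin 3)) π ≤ K ∧
        (∃ G' : ℝ → EuclideanSpace ℝ (Fin 3) → EuclideanSpace ℝ (Fin 3) →L[ℝ] EuclideanSpace ℝ (Fin 3),
          HasWeakSpatialGradientOn
              (parabolicCylinderOpens (2 * a) (0 : ℝ × EuclideanSpace ℝ (Fin 3))) w G' ∧
            cknAEss a (0 : ℝ × EuclideanSpace ℝ (Fin 3)) w +
              cknE a (0 : ℝ × EuclideanSpace ℝ (Fin 3)) G' ≤ K) ∧
        ENNReal.ofReal κ ≤ cknC a (0 : ℝ × EuclideanSpace ℝ (Fin 3)) w := by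
  obtain ⟨K, κ, lam, w, π, hκ, hlam, hlam0, hsingw, hall, hsym⟩ :=
    exists_ancientLimit_axisymmetric hsw hA hG hE hp hu_ax hp_ax hsing hI
  -- ### the axisymmetric representatives
  have hw_meas : ∀ a : ℝ, 0 < a → AEStronglyMeasurable (uncurry w)
      (volume.restrict (parabolicCylinder a (0 : ℝ × EuclideanSpace ℝ (Fin 3)))) :=
    fun a ha => (hall a ha).2.1.1
  have hπ_meas : ∀ a : ℝ, 0 < a → AEStronglyMeasurable (uncurry π)
      (volume.restrict (parabolicCylinder a (0 : ℝ × EuclideanSpace ℝ (Fin 3)))) :=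
    fun a ha => (hall a ha).1.2.2.2.1
  obtain ⟨w', hw'ax, hw'⟩ := exists_isAxisymmetric_repr hw_meas fun θ a ha => (hsym θ a ha).1
  obtain ⟨π', hπ'ax, hπ'⟩ := exists_isAxisymmetricScalar_repr hπ_meas fun θ a ha => (hsym θ a ha).2
  -- a.e. equalities in the direction consumed by the congruence lemmas
  have hww' : ∀ a : ℝ, 0 < a →
      ∀ᵐ z ∂(volume.restrict (parabolicCylinder a (0 : ℝ × EuclideanSpace ℝ (Fin 3)))),
        uncurry w z = uncurry w' z := fun a ha => (hw' a ha).mono fun z hz => hz.symm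
  have hππ' : ∀ a : ℝ, 0 < a →
      ∀ᵐ z ∂(volume.restrict (parabolicCylinder a (0 : ℝ × EuclideanSpace ℝ (Fin 3)))),
        uncurry π z = uncurry π' z := fun a ha => (hπ' a ha).mono fun z hz => hz.symm
  -- ### transfer of the a.e.-invariant properties
  have hball : ∀ a : ℝ, 0 < a → IsSuitableWeakSolutionInBall a 0 w' π' := fun a ha =>
    (hall a ha).1.congr_ae' (hww' a ha) (hππ' a ha)
  have hC : ∀ a : ℝ, 0 < a → cknC a (0 : ℝ × EuclideanSpace ℝ (Fin 3)) w' =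
      cknC a (0 : ℝ × EuclideanSpace ℝ (Fin 3)) w := fun a ha => (cknC_congr_ae (hww' a ha)).symm
  have hAe : ∀ a : ℝ, 0 < a → cknAEss a (0 : ℝ × EuclideanSpace ℝ (Fin 3)) w' =
      cknAEss a (0 : ℝ × EuclideanSpace ℝ (Fin 3)) w := fun a ha => (cknAEss_congr_ae (hww' a ha)).symm
  have hD : ∀ a : ℝ, 0 < a → cknD a (0 : ℝ × EuclideanSpace ℝ (Fin 3)) π' =
      cknD a (0 : ℝ × EuclideanSpace ℝ (Fin 3)) π := fun a ha => (cknD_congr_ae (hππ' a ha)).symm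
  -- ### the dissipation bound (𝒜)(iii) for `E`
  obtain ⟨K', hK'⟩ := exists_cknE_bound_of_forall_inBall (w := w') (π := π') (K := K)
    fun a ha => ⟨hball a ha, (hC a ha).le.trans (hall a ha).2.2.2.2.2.1,
      (hD a ha).le.trans (hall a ha).2.2.2.2.2.2.1⟩
  have hKle : (K : ℝ≥0∞) ≤ (max K K' : ℝ≥0) := ENNReal.coe_le_coe.2 (le_max_left _ _)
  have hK'le : (K' : ℝ≥0∞) ≤ (max K K' : ℝ≥0) := ENNReal.coe_le_coe.2 (le_max_right _ _)
  refine ⟨max K K', κ, lam, w', π', hκ, hlam, hlam0, ?_, hw'ax, hπ'ax, fun a ha => ?_⟩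
  · -- the origin stays singular
    refine hsingw.congr_ae (S := {z : ℝ × EuclideanSpace ℝ (Fin 3) | z.1 < 0}) (fun r hr z hz => ?_)
      (ae_restrict_halfSpace_of_forall hww')
    rw [mem_parabolicCylinder] at hz
    simpa using hz.1.2
  obtain ⟨h1, h2, h3, h4, h5, h6, h7, h8⟩ := hall a ha
  have hww'ae : uncurry w =ᵐ[volume.restrict (parabolicCylinder a (0 : ℝ × EuclideanSpace ℝ (Fin 3)))]
      uncurry w' := hww' a ha
  refine ⟨hball a ha, h2.ae_eq hww'ae, ?_, fun g hg => ?_, ?_, ?_, ?_, ?_, ?_⟩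
  · -- strong `L³` convergence of the rescaled velocities
    refine h3.congr fun j => eLpNorm_congr_ae ?_
    filter_upwards [hww'ae] with z hz
    simp only [Pi.sub_apply, hz]
  · -- weak `L^{3/2}` convergence of the rescaled pressures
    have e : ∫ w' in parabolicCylinder a (0 : ℝ × EuclideanSpace ℝ (Fin 3)), π' w'.1 w'.2 * g w' =
        ∫ w' in parabolicCylinder a (0 : ℝ × EuclideanSpace ℝ (Fin 3)), π w'.1 w'.2 * g w' := by
      refine integral_congr_ae ?_
      filter_upwards [hπ' a ha] with z hz
      have hz' : π' z.1 z.2 = π z.1 z.2 := hz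
      rw [hz']
    rw [e]
    exact h4 g hg
  · rw [hAe a ha]; exact h5.trans hKle
  · rw [hC a ha]; exact h6.trans hKle
  · rw [hD a ha]; exact h7.trans hKle
  · obtain ⟨G', hG', hb⟩ := hK' a ha
    exact ⟨G', hG', hb.trans hK'le⟩
  · rw [hC a ha]; exact h8

/-! ### The registered sub-stub -/

/-- **Sub-stub `stub_seregin2020TypeII_ancientLimit` of the crux `AxisymmetricKatoGlobal`**
(toward `stub_seregin2020TypeII`, Seregin 2020 Thm 2.1, properties (𝒜) and (2.9) of the blow-up
limit with (𝒜)(ii) pointwise): `cknD_congr_ae` and `exists_ancientLimit_isAxisymmetric`, conjoined.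
[cite: Seregin2020, proof of Thm 2.1, properties (𝒜)(i)–(iii) and (2.9)] -/
theorem stub_seregin2020TypeII_ancientLimit :
    (∀ (r : ℝ) (z : ℝ × EuclideanSpace ℝ (Fin 3)) (p p' : ℝ → EuclideanSpace ℝ (Fin 3) → ℝ),
      (∀ᵐ w ∂(volume.restrict (parabolicCylinder r z)), uncurry p w = uncurry p' w) →
      cknD r z p = cknD r z p') ∧
    (∀ (u : ℝ → EuclideanSpace ℝ (Fin 3) → EuclideanSpace ℝ (Fin 3))
      (p : ℝ → EuclideanSpace ℝ (Fin 3) → ℝ)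
      (G : ℝ → EuclideanSpace ℝ (Fin 3) → EuclideanSpace ℝ (Fin 3) →L[ℝ] EuclideanSpace ℝ (Fin 3)),
      IsSuitableWeakSolutionOn (SereginSverak2009.parCylOpens 0 1) 1 0 u p →
      (∃ C : ℝ≥0, ∀ᵐ t ∂(volume.restrict (Ioo (-1 : ℝ) 0)),
        ∫⁻ x in SereginSverak2009.spaceCyl 0 1, ‖u t x‖ₑ ^ 2 ≤ C) →
      HasWeakSpatialGradientOn (SereginSverak2009.parCylOpens 0 1) u G →
      (∫⁻ z in SereginSverak2009.parCyl 0 1, ENNReal.ofReal (frobeniusNormSq (G z.1 z.2)) < ∞) →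
      (∫⁻ z in SereginSverak2009.parCyl 0 1, ‖p z.1 z.2‖ₑ ^ (3 / 2 : ℝ) < ∞) →
      (∀ t ∈ Ioo (-1 : ℝ) 0, IsAxisymmetric (u t)) →
      (∀ t ∈ Ioo (-1 : ℝ) 0, IsAxisymmetricScalar (p t)) →
      IsBackwardSingularPoint u 0 → Seregin2020.blowupIndex 0 u G < ∞ →
      ∃ (K : ℝ≥0) (κ : ℝ) (lam : ℕ → ℝ)
        (w : ℝ → EuclideanSpace ℝ (Fin 3) → EuclideanSpace ℝ (Fin 3))
        (π : ℝ → EuclideanSpace ℝ (Fin 3) → ℝ),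
        0 < κ ∧ (∀ j, 0 < lam j) ∧ Tendsto lam atTop (𝓝 0) ∧
        IsBackwardSingularPoint w 0 ∧
        (∀ s, IsAxisymmetric (w s)) ∧ (∀ s, IsAxisymmetricScalar (π s)) ∧
        ∀ a : ℝ, 0 < a →
          IsSuitableWeakSolutionInBall a 0 w π ∧
          MemLp (uncurry w) 3
            (volume.restrict (parabolicCylinder a (0 : ℝ × EuclideanSpace ℝ (Fin 3)))) ∧
          Tendsto (fun j => eLpNorm
              (uncurry ((lam j) • stPull ((lam j) ^ 2) (lam j) (0 : ℝ)
                (0 : EuclideanSpace ℝ (Fin 3)) u) - uncurry w) 3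
              (volume.restrict (parabolicCylinder a (0 : ℝ × EuclideanSpace ℝ (Fin 3)))))
            atTop (𝓝 0) ∧
          (∀ g : ℝ × EuclideanSpace ℝ (Fin 3) → ℝ,
            MemLp g 3 (volume.restrict (parabolicCylinder a (0 : ℝ × EuclideanSpace ℝ (Fin 3)))) →
            Tendsto (fun j => ∫ w' in parabolicCylinder a (0 : ℝ × EuclideanSpace ℝ (Fin 3)),
                ((lam j) ^ 2 • stPull ((lam j) ^ 2) (lam j) (0 : ℝ)
                  (0 : EuclideanSpace ℝ (Fin 3)) p) w'.1 w'.2 * g w')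
              atTop (𝓝 (∫ w' in parabolicCylinder a (0 : ℝ × EuclideanSpace ℝ (Fin 3)),
                π w'.1 w'.2 * g w'))) ∧
          cknAEss a (0 : ℝ × EuclideanSpace ℝ (Fin 3)) w ≤ K ∧
          cknC a (0 : ℝ × EuclideanSpace ℝ (Fin 3)) w ≤ K ∧
          cknD a (0 : ℝ × EuclideanSpace ℝ (Fin 3)) π ≤ K ∧
          (∃ G' : ℝ → EuclideanSpace ℝ (Fin 3) → EuclideanSpace ℝ (Fin 3) →L[ℝ] EuclideanSpace ℝ (Fin 3),
            HasWeakSpatialGradientOn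
                (parabolicCylinderOpens (2 * a) (0 : ℝ × EuclideanSpace ℝ (Fin 3))) w G' ∧
              cknAEss a (0 : ℝ × EuclideanSpace ℝ (Fin 3)) w +
                cknE a (0 : ℝ × EuclideanSpace ℝ (Fin 3)) G' ≤ K) ∧
          ENNReal.ofReal κ ≤ cknC a (0 : ℝ × EuclideanSpace ℝ (Fin 3)) w) :=
  ⟨fun _ _ _ _ h => cknD_congr_ae h,
    fun _ _ _ hsw hA hG hE hp hu_ax hp_ax hsing hI =>
      exists_ancientLimit_isAxisymmetric hsw hA hG hE hp hu_ax hp_ax hsing hI⟩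

end Summit.NavierStokesRegularity.NavierStokesRegularity.Theorems.AxisymmetricKatoGlobal.EulerScaling

end
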